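import Summits.CriticalPhenomena.CardyFormulaZ2.Theorems.CardySusyWardDiscretisationFamilyExistsCover
import Summits.CriticalPhenomena.CardyFormulaZ2.Theorems.CardySusyWardDiscretisationFamilyExistsLocalSearch
import HarnessLib

/-!
# The far-pole criterion for no forcing at a cut endpoint — helper for `DiscretisationFamilyExists` (stmt-CriticalPhenomena-9644)

At an endpoint `v` of a cut edge `[u, v]` (`u = v + cornerUnit (m + 2)` the unique site of the
opposite label class `X` joined to `v`), the no-forcing condition
`closedBall (δv) (r v) ⊄ ⋃ x ∈ X, closedBall (δx) (r x)` (`r = infDist · ∂Ω`) is tested on the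
**probe points** `q_s = δv + s · δe`, `e = cornerUnit m` (the ray from `δv` AWAY from `u`),
`0 < sδ < r v`.  `not_closedBall_subset_of_farPole`: if no site of `X` other than `u` in the
`3 × 3` box `v + {0,1,2}·e + {-1,0,1}·e'` (`e' = cornerUnit (m + 1)`) covers a probe point, then the
disc of `v` is covered only if `δ + r v ≤ r u`, i.e. only for a DEGENERATE pair (the disc of `v`
inside that of `u`).  Indeed a covering disc of a probe point either belongs to `u` (giving
`δ + sδ ≤ r u`) or to a boundary site within `r x ≤ δ√2` of the probe, and the lattice points within
`δ√2` of the probe ray are `u` and the nine box sites (`int_box_of_sq_le`).  The box hypothesis is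
discharged topologically by the caller (sites of the box whose disc meets the probe are joined to
`δv` inside `Ω` within the box, hence lie on the side of `v`).  Purely metric; no lattice
combinatorics beyond `infDist_frontier_le_sqrt_two`.
-/

noncomputable section

open Set Metric
open Literature.Probability.LatticeModels Literature.Probability.Percolation

namespace Summit.CriticalPhenomena.CardyFormulaZ2.Theorems.DiscretisationFamilyExists

/-! ### Integer points near the probe ray -/

/-- **Integer points within `√2` of the ray.** If `(a - s)² + b² ≤ 2` with `a, b ∈ ℤ` and
`0 < s < 3/2`, then `(a, b) = (-1, 0)` or `0 ≤ a ≤ 2`, `|b| ≤ 1`. [folklore] -/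
theorem int_box_of_sq_le {a b : ℤ} {s : ℝ} (hs : 0 < s) (hs2 : s < 3 / 2)
    (h : ((a : ℝ) - s) ^ 2 + (b : ℝ) ^ 2 ≤ 2) :
    (a = -1 ∧ b = 0) ∨ (0 ≤ a ∧ a ≤ 2 ∧ -1 ≤ b ∧ b ≤ 1) := by
  have hb2 : (b : ℝ) ^ 2 ≤ 2 := by nlinarith [sq_nonneg ((a : ℝ) - s)]
  have hb : -1 ≤ b ∧ b ≤ 1 := by
    constructor
    · by_contra h'
      have : (b : ℝ) ≤ -2 := by exact_mod_cast (by omega : b ≤ -2)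
      nlinarith
    · by_contra h'
      have : (2 : ℝ) ≤ b := by exact_mod_cast (by omega : 2 ≤ b)
      nlinarith
  have ha2 : ((a : ℝ) - s) ^ 2 ≤ 2 := by nlinarith [sq_nonneg (b : ℝ)]
  have hale : a ≤ 2 := by
    by_contra h'
    have : (3 : ℝ) ≤ a := by exact_mod_cast (by omega : 3 ≤ a)
    nlinarith
  have hage : -1 ≤ a := by
    by_contra h'
    have : (a : ℝ) ≤ -2 := by exact_mod_cast (by omega : a ≤ -2)
    nlinarith
  by_cases ha : a = -1
  · left
    refine ⟨ha, ?_⟩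
    subst ha
    have hb1 : (b : ℝ) ^ 2 < 1 := by push_cast at h; nlinarith
    have h1 : -1 < b := by
      by_contra h'
      have : (b : ℝ) ≤ -1 := by exact_mod_cast (by omega : b ≤ -1)
      nlinarith
    have h2 : b < 1 := by
      by_contra h'
      have : (1 : ℝ) ≤ b := by exact_mod_cast (by omega : 1 ≤ b)
      nlinarith
    omega
  · right
    exact ⟨by omega, hale, hb.1, hb.2⟩

/-- The coordinates of the four unit vectors. [folklore] -/
theorem cornerUnit_apply_cases (m : Fin 4) :
    (cornerUnit m 0 = 1 ∧ cornerUnit m 1 = 0) ∨ (cornerUnit m 0 = 0 ∧ cornerUnit m 1 = 1) ∨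
      (cornerUnit m 0 = -1 ∧ cornerUnit m 1 = 0) ∨ (cornerUnit m 0 = 0 ∧ cornerUnit m 1 = -1) := by
  fin_cases m <;> decide

/-- `cornerUnit (m + 1)` is `cornerUnit m` turned counter-clockwise. [folklore] -/
theorem cornerUnit_succ_apply (m : Fin 4) :
    cornerUnit (m + 1) 0 = -cornerUnit m 1 ∧ cornerUnit (m + 1) 1 = cornerUnit m 0 := by
  fin_cases m <;> decide

/-- `cornerUnit (m + 2)` is `-cornerUnit m`, coordinatewise. [folklore] -/
theorem cornerUnit_add_two_apply (m : Fin 4) (i : Fin 2) :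
    cornerUnit (m + 2) i = -cornerUnit m i := by
  rw [cornerUnit_add_two]; rfl

/-- **Lattice points within `δ√2` of the probe ray.** If `δx` is within `δ√2` of
`δv + s·δ(cornerUnit m)` with `0 < s < 3/2`, then `x = v + cornerUnit (m + 2)` or
`x = v + a·cornerUnit m + b·cornerUnit (m + 1)` with `0 ≤ a ≤ 2`, `|b| ≤ 1`. [folklore] -/
theorem eq_or_box_of_dist_probe_le {δ : ℝ} (hδ : 0 < δ) (v x : Site 2) (m : Fin 4) {s : ℝ}
    (hs : 0 < s) (hs2 : s < 3 / 2)
    (hd : dist (meshPoint δ x) (meshPoint δ v + s • meshPoint δ (cornerUnit m)) ≤ Real.sqrt 2 * δ) :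
    x = v + cornerUnit (m + 2) ∨ ∃ a b : ℤ, 0 ≤ a ∧ a ≤ 2 ∧ -1 ≤ b ∧ b ≤ 1 ∧
      x = v + a • cornerUnit m + b • cornerUnit (m + 1) := by
  set d : Site 2 := x - v with hd'
  have hx : x = v + d := by rw [hd']; abel
  set e := cornerUnit m with he
  set a : ℤ := d 0 * e 0 + d 1 * e 1 with ha
  set b : ℤ := -(d 0 * e 1) + d 1 * e 0 with hb
  obtain ⟨hn0, hn1⟩ := cornerUnit_succ_apply m
  have hcases := cornerUnit_apply_cases m
  -- the squared distance in the frame `(e, e')`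
  have hsq : dist (meshPoint δ x) (meshPoint δ v + s • meshPoint δ (cornerUnit m)) ^ 2 =
      δ ^ 2 * (((a : ℝ) - s) ^ 2 + (b : ℝ) ^ 2) := by
    rw [hx, meshPoint_add, dist_eq_norm, show meshPoint δ v + meshPoint δ d -
      (meshPoint δ v + s • meshPoint δ (cornerUnit m)) = -(s • meshPoint δ (cornerUnit m) - meshPoint δ d) by ring,
      norm_neg, norm_smul_meshPoint_sub_sq, ha, hb, ← he]
    push_cast
    rcases hcases with ⟨h0, h1⟩ | ⟨h0, h1⟩ | ⟨h0, h1⟩ | ⟨h0, h1⟩ <;>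
      simp only [← he] at h0 h1 <;> rw [h0, h1] <;> push_cast <;> ring
  have hab : ((a : ℝ) - s) ^ 2 + (b : ℝ) ^ 2 ≤ 2 := by
    have h1 : dist (meshPoint δ x) (meshPoint δ v + s • meshPoint δ (cornerUnit m)) ^ 2 ≤ (Real.sqrt 2 * δ) ^ 2 :=
      pow_le_pow_left₀ dist_nonneg hd 2
    rw [hsq, mul_pow, Real.sq_sqrt (by norm_num : (0:ℝ) ≤ 2)] at h1
    nlinarith [sq_pos_of_pos hδ]
  -- reconstruct `d` from `(a, b)`
  have hrec : d = a • cornerUnit m + b • cornerUnit (m + 1) := by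
    funext i
    simp only [Pi.add_apply, Pi.smul_apply, smul_eq_mul]
    fin_cases i
    · show d 0 = a * cornerUnit m 0 + b * cornerUnit (m + 1) 0
      rw [hn0, ha, hb, ← he]
      rcases hcases with ⟨h0, h1⟩ | ⟨h0, h1⟩ | ⟨h0, h1⟩ | ⟨h0, h1⟩ <;>
        simp only [← he] at h0 h1 <;> rw [h0, h1] <;> ring
    · show d 1 = a * cornerUnit m 1 + b * cornerUnit (m + 1) 1
      rw [hn1, ha, hb, ← he]
      rcases hcases with ⟨h0, h1⟩ | ⟨h0, h1⟩ | ⟨h0, h1⟩ | ⟨h0, h1⟩ <;>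
        simp only [← he] at h0 h1 <;> rw [h0, h1] <;> ring
  rcases int_box_of_sq_le hs hs2 hab with ⟨ha1, hb0⟩ | ⟨h0a, ha2, hb1, hb1'⟩
  · left
    rw [hx, hrec, ha1, hb0, zero_smul, add_zero, neg_smul, one_smul, ← cornerUnit_add_two]
  · right
    exact ⟨a, b, h0a, ha2, hb1, hb1', by rw [hx, hrec, add_assoc]⟩

/-! ### The far-pole criterion -/

/-- **Far-pole criterion.** Let `v` be a boundary site, `X` a set of boundary sites not containing
`v`, `u = v + cornerUnit (m + 2)` (the partner), and suppose that no site of `X` other than `u` of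
the form `v + a·cornerUnit m + b·cornerUnit (m + 1)`, `0 ≤ a ≤ 2`, `|b| ≤ 1`, has a disc containing a
probe point `δv + s·δ(cornerUnit m)` with `0 < sδ < r v`.  If the pair is non-degenerate,
`¬ (δ + r v ≤ r u)`, then the disc of `v` is not covered by the discs of `X`. [folklore] -/
theorem not_closedBall_subset_of_farPole {E : DiscreteDobrushin} (hΩ : IsOpen E.Ω) (hδ : 0 < E.δ)
    {v : Site 2} (hv : v ∈ E.zdBoundary) {X : Set (Site 2)} (hX : X ⊆ E.zdBoundary) (m : Fin 4)
    (hside : ∀ x ∈ X, x ≠ v + cornerUnit (m + 2) → ∀ a b : ℤ, 0 ≤ a → a ≤ 2 → -1 ≤ b → b ≤ 1 →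
      x = v + a • cornerUnit m + b • cornerUnit (m + 1) → ∀ s : ℝ, 0 < s →
      s * E.δ < infDist (meshPoint E.δ v) (frontier E.Ω) →
      dist (meshPoint E.δ x) (meshPoint E.δ v + s • meshPoint E.δ (cornerUnit m)) ≤
        infDist (meshPoint E.δ x) (frontier E.Ω) → False)
    (hnd : ¬ E.δ + infDist (meshPoint E.δ v) (frontier E.Ω) ≤
      infDist (meshPoint E.δ (v + cornerUnit (m + 2))) (frontier E.Ω)) :
    ¬ closedBall (meshPoint E.δ v) (infDist (meshPoint E.δ v) (frontier E.Ω)) ⊆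
      ⋃ x ∈ X, closedBall (meshPoint E.δ x) (infDist (meshPoint E.δ x) (frontier E.Ω)) := by
  intro hcov
  set δ := E.δ with hδdef
  set ρv := infDist (meshPoint δ v) (frontier E.Ω) with hρv
  set ρu := infDist (meshPoint δ (v + cornerUnit (m + 2))) (frontier E.Ω) with hρu
  have hρv_pos : 0 < ρv := infDist_frontier_pos hΩ hδ hv
  have hρv_le : ρv ≤ Real.sqrt 2 * δ := infDist_frontier_le_sqrt_two hΩ hδ hv
  have hsqrt : Real.sqrt 2 < 3 / 2 := by
    rw [show (3:ℝ) / 2 = Real.sqrt ((3/2) ^ 2) by rw [Real.sqrt_sq (by norm_num)]]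
    exact Real.sqrt_lt_sqrt (by norm_num) (by norm_num)
  have hne : ‖meshPoint δ (cornerUnit m)‖ = δ := by
    rw [norm_meshPoint_cornerUnit, abs_of_pos hδ]
  -- every probe point is covered by the disc of the partner
  have key : ∀ s : ℝ, 0 < s → s * δ < ρv → δ + s * δ ≤ ρu := by
    intro s hs hsρ
    have hs2 : s < 3 / 2 := by
      have : s * δ < 3 / 2 * δ := hsρ.trans_le (hρv_le.trans (by nlinarith))
      exact lt_of_mul_lt_mul_right this hδ.le
    have hq : meshPoint δ v + s • meshPoint δ (cornerUnit m) ∈ closedBall (meshPoint δ v) ρv := by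
      rw [mem_closedBall, dist_eq_norm, add_sub_cancel_left, norm_smul, Real.norm_eq_abs,
        abs_of_pos hs, hne]
      exact hsρ.le
    obtain ⟨x, hxX, hqx⟩ := mem_iUnion₂.1 (hcov hq)
    rw [mem_closedBall, dist_comm] at hqx
    by_cases hxu : x = v + cornerUnit (m + 2)
    · rw [hxu] at hqx
      have : dist (meshPoint δ (v + cornerUnit (m + 2))) (meshPoint δ v + s • meshPoint δ (cornerUnit m)) =
          δ + s * δ := by
        rw [meshPoint_add, dist_eq_norm, show meshPoint δ v + meshPoint δ (cornerUnit (m + 2)) -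
          (meshPoint δ v + s • meshPoint δ (cornerUnit m)) = meshPoint δ (cornerUnit (m + 2)) - s • meshPoint δ (cornerUnit m) by ring,
          show meshPoint δ (cornerUnit (m + 2)) = -meshPoint δ (cornerUnit m) by
            rw [cornerUnit_add_two]; simp [meshPoint, Site.toComplex, Complex.ext_iff],
          show -meshPoint δ (cornerUnit m) - s • meshPoint δ (cornerUnit m) = -((1 + s) • meshPoint δ (cornerUnit m)) by
            rw [add_smul, one_smul]; ring,
          norm_neg, norm_smul, Real.norm_eq_abs, abs_of_pos (by linarith), hne]
        ring
      rw [this] at hqx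
      exact hqx
    · exfalso
      have hρx : infDist (meshPoint δ x) (frontier E.Ω) ≤ Real.sqrt 2 * δ :=
        infDist_frontier_le_sqrt_two hΩ hδ (hX hxX)
      rcases eq_or_box_of_dist_probe_le hδ v x m hs hs2 (hqx.trans hρx) with h | ⟨a, b, h0a, ha2, hb1, hb1', hxe⟩
      · exact hxu h
      · exact hside x hxX hxu a b h0a ha2 hb1 hb1' hxe s hs hsρ hqx
  -- hence `δ + r v ≤ r u`
  apply hnd
  by_contra hlt
  push Not at hlt
  set c := (max (ρu - δ) 0 + ρv) / 2 with hc
  have hmax_lt : max (ρu - δ) 0 < ρv := max_lt (by linarith) hρv_pos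
  have hc_pos : 0 < c := by
    have : 0 ≤ max (ρu - δ) 0 := le_max_right _ _
    rw [hc]; linarith
  have hc_lt : c < ρv := by rw [hc]; linarith
  have hc_gt : max (ρu - δ) 0 < c := by rw [hc]; linarith
  have := key (c / δ) (div_pos hc_pos hδ) (by rw [div_mul_cancel₀ _ hδ.ne']; exact hc_lt)
  rw [div_mul_cancel₀ _ hδ.ne'] at this
  have : ρu - δ < c := (le_max_left _ _).trans_lt hc_gt
  linarith


/-! ### Discharging the box hypothesis from the sides of a cross-cut -/

/-- Points of a segment between two points of the frame box `δv + [0,2]·δe + [-1,1]·δe'` lie in the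
box (convexity, with explicit coefficients). [folklore] -/
theorem exists_box_of_mem_segment {P E' N : ℂ} {α₁ β₁ α₂ β₂ : ℝ}
    (hα₁ : 0 ≤ α₁ ∧ α₁ ≤ 2) (hβ₁ : -1 ≤ β₁ ∧ β₁ ≤ 1) (hα₂ : 0 ≤ α₂ ∧ α₂ ≤ 2) (hβ₂ : -1 ≤ β₂ ∧ β₂ ≤ 1)
    {z : ℂ} (hz : z ∈ segment ℝ (P + α₁ • E' + β₁ • N) (P + α₂ • E' + β₂ • N)) :
    ∃ α β : ℝ, 0 ≤ α ∧ α ≤ 2 ∧ -1 ≤ β ∧ β ≤ 1 ∧ z = P + α • E' + β • N := by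
  rw [segment_eq_image] at hz
  obtain ⟨θ, ⟨hθ0, hθ1⟩, rfl⟩ := hz
  refine ⟨(1 - θ) * α₁ + θ * α₂, (1 - θ) * β₁ + θ * β₂, by nlinarith, by nlinarith, by nlinarith,
    by nlinarith, ?_⟩
  simp only [Complex.real_smul]
  push_cast
  ring

/-- **The box hypothesis of the far-pole criterion from the sides of a cross-cut.** Let `U₁`, `U₂`
be disjoint open sets with `Ω ∖ χ ⊆ U₁ ∪ U₂` (the two sides of a cross-cut `χ`), `v` a boundary site
with `δv ∈ U₂`, and suppose `χ ∩ Ω` misses the closed frame box `δv + [0,2]·δe + [-1,1]·δe'`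
(`e = cornerUnit m`, `e' = cornerUnit (m + 1)`).  Then no boundary site `x` of the box with
`δx ∈ U₁` has a disc `closedBall (δx) (r x)` containing a probe point `δv + s·δe`, `0 < sδ < r v`:
the broken line `δx → probe → δv` runs inside `Ω` (radii of empty discs) and inside the box, so
off `χ`, and would join the two sides. [folklore] -/
theorem farPole_side {E : DiscreteDobrushin} (hΩ : IsOpen E.Ω) (hδ : 0 < E.δ) {χ U₁ U₂ : Set ℂ}
    (h₁ : IsOpen U₁) (h₂ : IsOpen U₂) (hdisj : Disjoint U₁ U₂) (hcover : E.Ω \ χ ⊆ U₁ ∪ U₂)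
    {v : Site 2} (hv : v ∈ E.zdBoundary) (hvU : meshPoint E.δ v ∈ U₂) (m : Fin 4)
    (hbox : ∀ p ∈ χ, p ∈ E.Ω → ∀ α β : ℝ, 0 ≤ α → α ≤ 2 → -1 ≤ β → β ≤ 1 →
      p ≠ meshPoint E.δ v + α • meshPoint E.δ (cornerUnit m) + β • meshPoint E.δ (cornerUnit (m + 1)))
    {x : Site 2} (hx : x ∈ E.zdBoundary) (hxU : meshPoint E.δ x ∈ U₁)
    {a b : ℤ} (h0a : 0 ≤ a) (ha2 : a ≤ 2) (hb1 : -1 ≤ b) (hb1' : b ≤ 1)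
    (hxe : x = v + a • cornerUnit m + b • cornerUnit (m + 1)) {s : ℝ} (hs : 0 < s)
    (hsρ : s * E.δ < infDist (meshPoint E.δ v) (frontier E.Ω))
    (hq : dist (meshPoint E.δ x) (meshPoint E.δ v + s • meshPoint E.δ (cornerUnit m)) ≤
      infDist (meshPoint E.δ x) (frontier E.Ω)) : False := by
  set δ := E.δ with hδdef
  set P := meshPoint δ v
  set E' := meshPoint δ (cornerUnit m)
  set N := meshPoint δ (cornerUnit (m + 1))
  set q := P + s • E' with hqdef
  set ρv := infDist P (frontier E.Ω)
  set ρx := infDist (meshPoint δ x) (frontier E.Ω)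
  have hvΩ : P ∈ E.Ω := meshDomain_subset_meshVertices _ _ (E.zdBoundary_subset_meshDomain hv)
  have hxΩ : meshPoint δ x ∈ E.Ω := meshDomain_subset_meshVertices _ _ (E.zdBoundary_subset_meshDomain hx)
  have hρx_pos : 0 < ρx := infDist_frontier_pos hΩ hδ hx
  have hρv_le : ρv ≤ Real.sqrt 2 * δ := infDist_frontier_le_sqrt_two hΩ hδ hv
  have hne : ‖E'‖ = δ := by
    show ‖meshPoint δ (cornerUnit m)‖ = δ
    rw [norm_meshPoint_cornerUnit, abs_of_pos hδ]
  have hs2 : s ≤ 2 := by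
    have h2 : Real.sqrt 2 ≤ 2 := by
      rw [show (2:ℝ) = Real.sqrt (2 ^ 2) by rw [Real.sqrt_sq (by norm_num)]]
      exact Real.sqrt_le_sqrt (by norm_num)
    have : s * δ < 2 * δ := hsρ.trans_le (hρv_le.trans (by nlinarith))
    exact (lt_of_mul_lt_mul_right this hδ.le).le
  -- the mesh point of `x` in the frame
  have hzsmul : ∀ (c : ℤ) (y : Site 2), meshPoint δ (c • y) = (c : ℝ) • meshPoint δ y := by
    intro c y
    apply Complex.ext
    · simp only [meshPoint_re, Pi.smul_apply, smul_eq_mul, Int.cast_mul, Complex.real_smul,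
        Complex.mul_re, Complex.ofReal_re, Complex.ofReal_im, meshPoint_im]
      ring
    · simp only [meshPoint_im, Pi.smul_apply, smul_eq_mul, Int.cast_mul, Complex.real_smul,
        Complex.mul_im, Complex.ofReal_re, Complex.ofReal_im, meshPoint_re]
      ring
  have hxP : meshPoint δ x = P + (a : ℝ) • E' + (b : ℝ) • N := by
    rw [hxe, meshPoint_add, meshPoint_add, hzsmul, hzsmul]
  -- the probe point lies in `Ω`
  have hqΩ : q ∈ E.Ω := by
    refine ball_infDist_frontier_subset' hΩ hvΩ ?_
    rw [mem_ball, dist_eq_norm, hqdef, add_sub_cancel_left, norm_smul, Real.norm_eq_abs,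
      abs_of_pos hs, hne]
    exact hsρ
  -- the broken line and its properties
  set S := segment ℝ (meshPoint δ x) q ∪ segment ℝ q P with hS
  have hSconn : IsPreconnected S :=
    IsPreconnected.union q (right_mem_segment _ _ _) (left_mem_segment _ _ _)
      (convex_segment _ _).isPreconnected (convex_segment _ _).isPreconnected
  have hSΩ : S ⊆ E.Ω := by
    rintro z (hz | hz)
    · rw [segment_eq_image] at hz
      obtain ⟨θ, ⟨hθ0, hθ1⟩, rfl⟩ := hz
      rcases eq_or_lt_of_le hθ1 with rfl | hθ1
      · simpa using hqΩ
      · refine ball_infDist_frontier_subset' hΩ hxΩ ?_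
        rw [mem_ball, dist_eq_norm, show (1 - θ) • meshPoint δ x + θ • q - meshPoint δ x = θ • (q - meshPoint δ x) by
          rw [smul_sub, sub_smul, one_smul]; abel, norm_smul, Real.norm_eq_abs, abs_of_nonneg hθ0]
        have hqx : ‖q - meshPoint δ x‖ ≤ ρx := by rw [← dist_eq_norm, dist_comm]; exact hq
        calc θ * ‖q - meshPoint δ x‖ ≤ θ * ρx := mul_le_mul_of_nonneg_left hqx hθ0
          _ < ρx := by nlinarith
    · refine ball_infDist_frontier_subset' hΩ hvΩ ?_
      have h1 : dist q P ≤ s * δ := by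
        rw [dist_eq_norm, hqdef, add_sub_cancel_left, norm_smul, Real.norm_eq_abs, abs_of_pos hs, hne]
      have h2 : dist P P ≤ s * δ := by rw [dist_self]; positivity
      exact lt_of_le_of_lt (dist_le_of_mem_segment hz h1 h2) hsρ
  have hSbox : ∀ z ∈ S, ∃ α β : ℝ, 0 ≤ α ∧ α ≤ 2 ∧ -1 ≤ β ∧ β ≤ 1 ∧ z = P + α • E' + β • N := by
    rintro z (hz | hz)
    · have hz' : z ∈ segment ℝ (P + (a : ℝ) • E' + (b : ℝ) • N) (P + s • E' + (0 : ℝ) • N) := by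
        simpa [hxP, hqdef] using hz
      exact exists_box_of_mem_segment ⟨by exact_mod_cast h0a, by exact_mod_cast ha2⟩
        ⟨by exact_mod_cast hb1, by exact_mod_cast hb1'⟩ ⟨hs.le, hs2⟩ ⟨by norm_num, by norm_num⟩ hz'
    · have hz' : z ∈ segment ℝ (P + s • E' + (0 : ℝ) • N) (P + (0 : ℝ) • E' + (0 : ℝ) • N) := by
        simpa [hqdef] using hz
      exact exists_box_of_mem_segment (α₂ := 0) (β₂ := 0) ⟨hs.le, hs2⟩ ⟨by norm_num, by norm_num⟩
        ⟨le_rfl, by norm_num⟩ ⟨by norm_num, by norm_num⟩ hz'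
  have hSχ : Disjoint S χ := by
    rw [Set.disjoint_left]
    intro z hzS hzχ
    obtain ⟨α, β, h0α, hα2, hβ1, hβ1', hz⟩ := hSbox z hzS
    exact hbox z hzχ (hSΩ hzS) α β h0α hα2 hβ1 hβ1' hz
  have hSU : S ⊆ U₁ ∪ U₂ := fun z hz => hcover ⟨hSΩ hz, Set.disjoint_left.1 hSχ hz⟩
  have hxS : meshPoint δ x ∈ S := Or.inl (left_mem_segment _ _ _)
  have hPS : P ∈ S := Or.inr (right_mem_segment _ _ _)
  rcases hSconn.subset_or_subset h₁ h₂ hdisj hSU with h | h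
  · exact Set.disjoint_left.1 hdisj (h hPS) hvU
  · exact Set.disjoint_left.1 hdisj hxU (h hxS)

end Summit.CriticalPhenomena.CardyFormulaZ2.Theorems.DiscretisationFamilyExists

end
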